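import Literature.NumberTheory.EllipticCurves.ZpExtensionEisensteinGradedInvariantsBoundProofs
import Literature.NumberTheory.EllipticCurves.TorsionFilAtCardProofs
import Literature.NumberTheory.EllipticCurves.Greenberg1999.KummerImageGoodOrdinaryNumberField
import Literature.NumberTheory.EllipticCurves.ZpExtensionEisensteinTowerReadoutCurve
import Literature.NumberTheory.EllipticCurves.ZpExtensionEisensteinOrdinaryCoboundaryShiftProofs
import Literature.NumberTheory.EllipticCurves.ZpExtensionEisensteinGradedInvariantsBoundMultiplicativeThreeProofs
import Literature.NumberTheory.EllipticCurves.LocalKernelOfReductionDivisibleThreeProofs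
import HarnessLib

/-!
# The coboundary shift modulo the kernel of reduction at a place `v ∣ 3` of MULTIPLICATIVE reduction
# (theorems only — no definition, no named fact, no instance, no `sorry`)

Topic `NumberTheory/EllipticCurves` (LEAD `bsd-wall-utd-p1`, crux r205 stmt-BirchSwinnertonDyer-24737 `TwinAlgMuZeroAtThree`,
line `beta-road`, stub `stub_howardOutputsOfFamily`, E2 assembly at `v ∣ 3`).  The three curve-level theorems of x9's
`ZpExtensionEisensteinOrdinaryCoboundaryShiftProofs` (`exists_mem_plus_pow_nsmul_eq`, `exists_int_smul_grMk_eq`,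
`exists_shift_coboundary_mod_kernelOfReduction`) assume GOOD reduction with an ordinary point, used only through
`exists_nsmul_eq_of_mem_localKernelOfReduction` (`E₁` is `p`-divisible) and `exists_int_scalar_torsionFilAt`; at places of
MULTIPLICATIVE reduction above `3` these are `LocalKernelOfReductionDivisibleThreeProofs` /
`ZpExtensionEisensteinGradedInvariantsBoundMultiplicativeThreeProofs`.  This file: x9's statements and proofs at `p = 3` with
`(hgood, hord)` replaced by `hmult` (generic §1 of x9's file imported, not restated).  BSD is not proved by any of this.

References: [Howard2004HeegnerKolyvagin] §3.2; [GreenbergLNM1716] §2; [SerreGaloisCohomology1997] I §2.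
-/

noncomputable section

open scoped Classical

open NumberField IsDedekindDomain Field
open Literature.NumberTheory.EllipticCurves Literature.NumberTheory.GaloisRepresentations
open Literature.NumberTheory.EllipticCurves.GreenbergSelmer

namespace WeierstrassCurve

open Literature.NumberTheory.EllipticCurves

variable {K : Type} [Field K] [NumberField K] (V : WeierstrassCurve K) [V.IsElliptic]
  (κ : ZpExtension K 3) (v : HeightOneSpectrum (𝓞 K))

/-- **`C_v` is `p^n`-divisible inside `E[p^∞]`** at a place `v ∋ p` of good reduction with an ordinary point: every
`c ∈ C_v = E[p^∞] ∩ E₁(K̄_v)` is `p^n • c′` with `c′ ∈ C_v` (`E₁(K̄_v)` is `p`-divisible and its torsion points are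
geometric). [cite: GreenbergLNM1716, §1 p. 62 and §2 p. 82 («since 𝓕(𝔪̄) is divisible»)] -/
theorem exists_mem_plus_pow_nsmul_eq_of_hasMultiplicativeReductionAt_three (hpv : ((3 : ℕ) : 𝓞 K) ∈ v.asIdeal) (hmult : V.HasMultiplicativeReductionAt v) (n : ℕ)
    {c : V.geomPrimaryTorsion 3} (hc : c ∈ (V.kernelOfReductionLocalDatum 3 v).plus) :
    ∃ c' : V.geomPrimaryTorsion 3, c' ∈ (V.kernelOfReductionLocalDatum 3 v).plus ∧ 3 ^ n • c' = c := by
  -- `p^n`-divide the image `a ∈ E₁(K̄_v)` of `c`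
  have hdiv : ∀ (j : ℕ) {a : localPoints V (v.adicCompletion K)}, a ∈ V.localKernelOfReduction v →
      ∃ b : localPoints V (v.adicCompletion K), b ∈ V.localKernelOfReduction v ∧ 3 ^ j • b = a := by
    intro j
    induction j with
    | zero => intro a ha; exact ⟨a, ha, by rw [pow_zero, one_smul]⟩
    | succ j ih =>
      intro a ha
      obtain ⟨b, hb, rfl⟩ := ih ha
      obtain ⟨b', hb', rfl⟩ := V.exists_nsmul_eq_of_mem_localKernelOfReduction_of_hasMultiplicativeReductionAt_three v hpv hmult hb
      exact ⟨b', hb', by rw [pow_succ, mul_smul]⟩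
  rw [mem_kernelOfReductionLocalDatum_plus_iff] at hc
  obtain ⟨b, hb, hbc⟩ := hdiv n hc
  -- `c` is `p`-primary, so `b` is torsion, hence geometric
  obtain ⟨n₀, hn₀⟩ := (AddCommGroup.mem_primaryComponent (G := geomPoints V) (p := 3)).1 c.2
  have hbtors : ((3 ^ (n + n₀) : ℕ) : ℤ) • b = 0 := by
    rw [natCast_zsmul, pow_add, mul_comm, mul_smul, hbc, ← map_nsmul, hn₀, map_zero]
  obtain ⟨Q, hQ0, hQb⟩ := V.exists_geomTorsion_pointsMapOfEmb_eq v (n + n₀) b hbtors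
  have hQprim : Q ∈ V.geomPrimaryTorsion 3 :=
    (AddCommGroup.mem_primaryComponent (G := geomPoints V) (p := 3)).2 ⟨n + n₀, by rwa [natCast_zsmul] at hQ0⟩
  refine ⟨⟨Q, hQprim⟩, ?_, ?_⟩
  · rw [mem_kernelOfReductionLocalDatum_plus_iff]
    change pointsMapOfEmb V (closureEmb (K := K) (v.adicCompletion K)) Q ∈ _
    rw [hQb]; exact hb
  · apply Subtype.ext
    apply pointsMapOfEmb_injective V (closureEmb (K := K) (v.adicCompletion K))
    change pointsMapOfEmb V _ (3 ^ n • Q) = pointsMapOfEmb V _ (c : geomPoints V)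
    rw [map_nsmul, hQb, hbc]; rfl

/-- **The decomposition group acts on the images of the `E[p^k]` in `E[p^∞]/C_v` through integer scalars**
(`E[p^k]/Fil_v E[p^k]` is cyclic: `exists_int_scalar_torsionFilAt`).
[cite: Howard2004HeegnerKolyvagin, §3.1 (arXiv:1202.6340 p. 15 L56–62)] [cite: GreenbergLNM1716, §2 (the action on Ẽ[p^k])] -/
theorem exists_int_smul_grMk_eq_of_hasMultiplicativeReductionAt_three (hpv : ((3 : ℕ) : 𝓞 K) ∈ v.asIdeal) (hmult : V.HasMultiplicativeReductionAt v)
    (δ : decomp (K := K) v) (k : ℕ) :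
    ∃ c : ℤ, ∀ q ∈ ((V.kernelOfReductionLocalDatum 3 v).grMk.comp
        (AddSubgroup.inclusion (AcSigned.geomTorsion_zpow_le_geomPrimaryTorsion V 3 k))).range,
      δ • q = c • q := by
  obtain ⟨σ₀, hσ₀⟩ := (mem_decomp_iff v _).1 δ.2
  -- scalar at level `k + 1 ≥ 1`, restricted to level `k`
  obtain ⟨n₀, -, -, hn₀, -⟩ := V.exists_int_scalar_torsionFilAt_of_hasMultiplicativeReductionAt_three v hpv hmult (Nat.le_add_left 1 k) σ₀
  refine ⟨n₀, ?_⟩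
  rintro _ ⟨a, rfl⟩
  set a' : geomTorsion V (((3 : ℕ) : ℤ) ^ (k + 1)) :=
    AddSubgroup.inclusion (geomTorsion_le_of_dvd V (pow_dvd_pow ((3 : ℕ) : ℤ) (Nat.le_succ k))) a with ha'
  have hincl : AddSubgroup.inclusion (AcSigned.geomTorsion_zpow_le_geomPrimaryTorsion V 3 k) a =
      AddSubgroup.inclusion (AcSigned.geomTorsion_zpow_le_geomPrimaryTorsion V 3 (k + 1)) a' := rfl
  rw [AddMonoidHom.comp_apply, hincl, LocalDatum.smul_grMk, ← hσ₀, ← sub_eq_zero, ← map_zsmul, ← map_sub,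
    ← AddMonoidHom.mem_ker, LocalDatum.ker_grMk, mem_kernelOfReductionLocalDatum_plus_iff]
  have h := hn₀ a'
  rw [mem_torsionFilAt_iff] at h
  exact h

/-- **Shifting coboundaries modulo `C_v` up the levels.** At a place `v ∋ p` of good reduction with an ordinary point
there is `e : ℕ` (depending only on `E`, `v` and the `ℤ_p`-extension `κ`) such that, for every `k`: if a function
`f : (ker κ ⊓ D_v) → E[p^k]` is, modulo `C_v`, the coboundary of some class `q ∈ E[p^∞]/C_v`, then it is, modulo `C_v`,
the coboundary of a point `q̂ ∈ E[p^{k+e}]`.  (Dichotomy: either `ker κ ⊓ D_v` acts trivially on `E[p^∞]/C_v`, or its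
fixed points there have bounded exponent `p^e`, and `p^k • q` is fixed; then divide inside `C_v`.)
[cite: GreenbergLNM1716, §2 Prop. 2.2 and Prop. 2.4 (pp. 73–80)] [cite: Howard2004HeegnerKolyvagin, Lemma 2.2.7 / Prop. 2.2.8] -/
theorem exists_shift_coboundary_mod_kernelOfReduction_of_hasMultiplicativeReductionAt_three (hpv : ((3 : ℕ) : 𝓞 K) ∈ v.asIdeal) (hmult : V.HasMultiplicativeReductionAt v) :
    ∃ e : ℕ, ∀ (k : ℕ) (f : decompIn κ.kerSubgroup v → geomTorsion V (((3 : ℕ) : ℤ) ^ k))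
      (q : (V.kernelOfReductionLocalDatum 3 v).Gr),
      (∀ y, (V.kernelOfReductionLocalDatum 3 v).grMk
          (AddSubgroup.inclusion (AcSigned.geomTorsion_zpow_le_geomPrimaryTorsion V 3 k) (f y)) = y • q - q) →
      ∃ qhat : geomTorsion V (((3 : ℕ) : ℤ) ^ (k + e)), ∀ y : decompIn κ.kerSubgroup v,
        AddSubgroup.inclusion (AcSigned.geomTorsion_zpow_le_geomPrimaryTorsion V 3 k) (f y) -
          ((((y : decomp (K := K) v) : absoluteGaloisGroup K) •
              AddSubgroup.inclusion (AcSigned.geomTorsion_zpow_le_geomPrimaryTorsion V 3 (k + e)) qhat) -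
            AddSubgroup.inclusion (AcSigned.geomTorsion_zpow_le_geomPrimaryTorsion V 3 (k + e)) qhat) ∈
          (V.kernelOfReductionLocalDatum 3 v).plus := by
  set N := V.kernelOfReductionLocalDatum 3 v with hN
  -- the levels `L k = image of E[p^k]` in `E[p^∞]/C_v` and the action of `ker κ ⊓ D_v`
  set L : ℕ → AddSubgroup N.Gr := fun k ↦
    (N.grMk.comp (AddSubgroup.inclusion (AcSigned.geomTorsion_zpow_le_geomPrimaryTorsion V 3 k))).range with hL
  set act : decompIn κ.kerSubgroup v → N.Gr →+ N.Gr := fun y ↦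
    DistribSMul.toAddMonoidHom N.Gr (y : decomp (K := K) v) with hact
  have hLk : ∀ k, ∀ q ∈ L k, 3 ^ k • q = 0 := by
    rintro k _ ⟨a, rfl⟩
    rw [← map_nsmul, V.geomTorsion_pow_nsmul_eq_zero 3 k a, map_zero]
  have hmono : Monotone L := by
    refine monotone_nat_of_le_succ fun k ↦ ?_
    rintro _ ⟨a, rfl⟩
    exact ⟨AddSubgroup.inclusion (geomTorsion_le_of_dvd V (pow_dvd_pow ((3 : ℕ) : ℤ) (Nat.le_succ k))) a, rfl⟩
  have hcov : ∀ q, ∃ k, q ∈ L k := by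
    intro q
    obtain ⟨P, rfl⟩ := N.grMk_surjective q
    obtain ⟨n, hn⟩ := (AddCommGroup.mem_primaryComponent (G := geomPoints V) (p := 3)).1 P.2
    refine ⟨n, ⟨⟨(P : geomPoints V), ?_⟩, rfl⟩⟩
    rw [mem_geomTorsion_iff, ← Nat.cast_pow, natCast_zsmul, hn]
  have hscalar : ∀ y k, ∃ c : ℤ, ∀ q ∈ L k, act y q = c • q := fun y k ↦
    V.exists_int_smul_grMk_eq_of_hasMultiplicativeReductionAt_three v hpv hmult (y : decomp (K := K) v) k
  obtain ⟨e, he⟩ := exists_forall_coboundary_eq_of_pow_nsmul_eq_zero act 3 L hLk hmono hcov hscalar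
  refine ⟨e, fun k f q hq ↦ ?_⟩
  -- the values of the coboundary are killed by `p^k`
  have hval : ∀ y, 3 ^ k • (act y q - q) = 0 := fun y ↦ by
    have h : act y q - q = N.grMk (AddSubgroup.inclusion (AcSigned.geomTorsion_zpow_le_geomPrimaryTorsion V 3 k) (f y)) :=
      (hq y).symm
    rw [h, ← map_nsmul, ← map_nsmul, V.geomTorsion_pow_nsmul_eq_zero 3 k (f y), map_zero, map_zero]
  obtain ⟨q', hq', hcob⟩ := he k q hval
  -- lift `q'` to a point `P ∈ E[p^∞]` and correct it inside `C_v`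
  obtain ⟨P, rfl⟩ := N.grMk_surjective q'
  have hPker : 3 ^ (k + e) • P ∈ N.plus := by
    rw [← LocalDatum.ker_grMk, AddMonoidHom.mem_ker, map_nsmul, hq']
  obtain ⟨c', hc', hc'P⟩ := V.exists_mem_plus_pow_nsmul_eq_of_hasMultiplicativeReductionAt_three v hpv hmult (k + e) hPker
  have hmem : ((P - c' : V.geomPrimaryTorsion 3) : geomPoints V) ∈ geomTorsion V (((3 : ℕ) : ℤ) ^ (k + e)) := by
    rw [mem_geomTorsion_iff, ← Nat.cast_pow, natCast_zsmul, AddSubgroupClass.coe_sub, smul_sub, sub_eq_zero,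
      ← AddSubgroupClass.coe_nsmul, ← AddSubgroupClass.coe_nsmul, hc'P]
  refine ⟨⟨((P - c' : V.geomPrimaryTorsion 3) : geomPoints V), hmem⟩, fun y ↦ ?_⟩
  have hincl : AddSubgroup.inclusion (AcSigned.geomTorsion_zpow_le_geomPrimaryTorsion V 3 (k + e))
      ⟨((P - c' : V.geomPrimaryTorsion 3) : geomPoints V), hmem⟩ = P - c' := rfl
  have hc'0 : N.grMk c' = 0 := by rw [← AddMonoidHom.mem_ker, LocalDatum.ker_grMk]; exact hc'
  have h : (y : decomp (K := K) v) • N.grMk P - N.grMk P = (y : decomp (K := K) v) • q - q := hcob y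
  rw [hincl, ← LocalDatum.ker_grMk, AddMonoidHom.mem_ker, map_sub, map_sub, hq y, ← LocalDatum.smul_grMk, map_sub,
    hc'0, sub_zero]
  change (y : decomp (K := K) v) • q - q - ((y : decomp (K := K) v) • N.grMk P - N.grMk P) = 0
  rw [h, sub_self]

end WeierstrassCurve

end
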